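/-
Copyright (c) 2026 the pub-hodgecm-mathlib formalisation cell (harness21).  Prover seat hodgecm-mathlib-B-p14 (g35), generic organ for road «S3-tree»
(census «S3» v2 §4 (R-T), brick T1; my census `F0/P3a/B-p14/g35/CENSUS-T1-U3Tree.B-p14g35.md` §2 (d) ∕ §7), LEAD F0P3a-plan (g10) WORD T9-49 (4)
«generic-organ work only»; 2026-09-01.  Companion of ★ `HyperspecialUnitaryIwasawa` §3 and ★ `UnitaryAntidiagAnisotropicTransitivity` (B-p14 (g30)).
-/
import Literature.NumberTheory.Automorphic.UnitaryAntidiagAnisotropicTransitivity   -- ★ `exists_rev_ne_v_eq_one_of_v_B₀_lt_one`; brings ★ `HyperspecialUnitaryIwasawa` (`exists_mem_unitaryInt_mulVec_single_eq`), `B₀`, `stdLattice`, `unitaryInt`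
import HarnessLib

/-!
# `K₀ = U(J₀) ∩ GL_N(𝒪)` is transitive on the ISOTROPIC-LINE NEIGHBOURS of the hyperspecial vertex: every residually isotropic primitive vector of `𝒪^N`
# is congruent modulo `𝔪` to a column of an element of `K₀` (Bruhat–Tits 1972 (4.4.4); Tits 1979 §3.3.3; Serre, *Trees* II.1.1)

Topic `NumberTheory/Automorphic`; namespace `Literature.NumberTheory.Automorphic.HermitianLattice`.  THEOREMS ONLY (no definition, no instance, no notation, no
named fact, no `sorry`); kernel lane.  Cell `pub/hodgecm-mathlib` (D-0151), crux H413 = `stmt-HodgeConjecture-24833`; a GENERIC organ typed ahead of road «S3-tree»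
(architect A-p16 (g28), census «S3» v2 §4 (R-T) «T1: the `U(3)_v` tree + action + stabilisers»): the rank-`N` form of the ONE structural input the rank-3 lattice
tree needs beyond ★ `exists_frame_cartan` — «`K₀` is transitive on the type-one vertices adjacent to the root `L₀ = 𝒪^N`» (the rank-2 precedent is ★
`HermitianLatticeTreeFlagTransitive` §3–§4, `exists_mem_glInt_mover` ∕ `forall_isModularLattice_rootStar_exists_latt_mul_eq`, in `ValuativeRel` currency at `N = 2`).

SETTING (★ `UnitaryAntidiagFrames` ∕ ★ `HyperspecialUnitaryIwasawa`): `K` a field with `Valued K ℤᵐ⁰`, `σ : K →+* K` an involution preserving the valuation, `J₀ = antidiag(1,…,1)`,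
`B₀ σ N x y = Σ σ(x_i) y_{rev i}`, `𝒪^N = stdLattice K N`, `K₀ = unitaryInt σ (J₀.over K)`, `e_l = Pi.single l 1`; a TRACE ELEMENT is a `τ ∈ 𝒪` with `τ + στ = 1`
(★ `UnramifiedLocalConjDatum.trace` at an unramified place of EVERY residue characteristic; `τ = ½` whenever `|2| = 1`, §0 — e.g. a tame ramified place).

THE MATHEMATICS.  For `x ∈ 𝒪^N` PRIMITIVE (a unit coordinate) and RESIDUALLY ISOTROPIC (`|B₀ x x| < 1`), the sublattice
`N_x := {y ∈ 𝒪^N | B₀ x y ∈ 𝔪}` depends only on `x mod 𝔪`; at `N = 3` (unramified `U(3)`) the `N_x` are exactly the `q³ + 1` TYPE-ONE lattices `ϖL₀ ≤ N ≤ L₀` adjacent to the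
hyperspecial vertex `L₀` of the Bruhat–Tits tree (`N_x∕ϖL₀ = ℓ_x^⊥`, `ℓ_x` the isotropic residual line of `x`), the standard one being `N_{e_{i₀}} = {y | y_{rev i₀} ∈ 𝔪}`.
(§1) ISOTROPIC LIFT: at a unit coordinate `j` (`rev j ≠ j`; ★ `exists_rev_ne_v_eq_one_of_v_B₀_lt_one` provides one) put `a := B₀ x x` (`σa = a`, `|a| < 1`) and
`x̃ := x − c·e_{rev j}`, `c := τ a ∕ σ(x_j)`: then `B₀ x̃ x̃ = a − cσ(x_j) − σ(c)x_j = a − (τ + στ)a = 0`, `x̃ ≡ x (mod a)`, `x̃_j = x_j` — no Hensel, no `|2| = 1`.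
(§2) ★ `exists_mem_unitaryInt_mulVec_single_eq` moves `e_{i₀}` to the exactly isotropic primitive `x̃` by some `k ∈ K₀`, so `k e_{i₀} ≡ x (mod a)`.
(§3) LATTICE DRESS (definition-free): unitarity `B₀(k e_{i₀}, y) = B₀(e_{i₀}, k⁻¹y) = (k⁻¹y)_{rev i₀}` and the ultrametric inequality give
`∀ y ∈ 𝒪^N, B₀ x y ∈ 𝔪 ↔ (k⁻¹y)_{rev i₀} ∈ 𝔪`, i.e. `N_x = k · N_{e_{i₀}}`; hence (§4) for two such vectors `x, x′` some `k ∈ K₀` has `N_{x′} = k · N_x`.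

* §0 `exists_traceElem_of_v_two_eq_one` (`τ = ½`), `v_B₀_le_of_forall_v_le` (`|B₀ d y| ≤ r` if `|d_i| ≤ r`, `y ∈ 𝒪^N`), `mulVec_mem_stdLattice_of_mem_unitaryInt(_inv)`,
  `B₀_mulVec_eq_B₀_inv_mulVec` (`B₀ (k u) y = B₀ u (k⁻¹ y)`).
* §1 **`exists_isotropic_congr`**.  §2 **`exists_mem_unitaryInt_mulVec_single_congr`**.
* §3 **`exists_mem_unitaryInt_rootStar_eq`** (`N_x = k·N_{e_{i₀}}`).  §4 **`exists_mem_unitaryInt_rootStar_transitive`** (`N_{x′} = k·N_x`).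

HONEST LABEL: HC_CM is proved only modulo the cell's 2 remaining named inputs (hLiu418 24832, h413 24833) until rung 0 closes; this file is local structure theory
(elementary lattice algebra over a valuation ring), asserts nothing printed and pays no books row by itself.

## References
* [BruhatTits1972] F. Bruhat, J. Tits, *Groupes réductifs sur un corps local I*, Publ. Math. IHÉS 41 (1972), (4.4.4) (a good maximal compact subgroup is transitive on the
  chambers containing its vertex), §10 (rank one: the building is a tree).
* [Tits1979] J. Tits, *Reductive groups over local fields*, PSPM 33.1 (1979), §3.3.3 (`K₀ = 𝒢(𝒪)` and its reduction), §3.5 (the residual building is the link of the vertex).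
* [Serre1980Trees] J.-P. Serre, *Trees* (1980), Ch. II §1.1 (the star of a vertex of the tree of `SL₂` = the projective line over the residue field).
* [Omeara1963] O. T. O'Meara, *Introduction to Quadratic Forms* (1963), §82F (primitive vectors of a unimodular lattice).
-/

set_option autoImplicit false

noncomputable section

open scoped Valued WithZero Matrix MatrixGroups

namespace Literature.NumberTheory.Automorphic.HermitianLattice

variable {K : Type*} [Field K] [Valued K ℤᵐ⁰] {σ : K →+* K} {N : ℕ}

/-! ## §0 Plumbing: trace element `½`, valuation of `B₀` against a small vector, `K₀` preserves `𝒪^N`, `B₀ (k u) y = B₀ u (k⁻¹ y)` -/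

/-- **`τ = ½` is a trace element when `|2| = 1`** (`σ(½) = ½`, so `½ + σ(½) = 1`): the non-dyadic case of the hypothesis `τ + στ = 1` used below (at an
unramified place of any residue characteristic use ★ `UnramifiedLocalConjDatum.trace` instead). [cite: Omeara1963, §82F] -/
theorem exists_traceElem_of_v_two_eq_one (h2 : Valued.v (2 : K) = 1) : ∃ τ : K, Valued.v τ ≤ 1 ∧ τ + σ τ = 1 := by
  have h20 : (2 : K) ≠ 0 := fun h => by rw [h, map_zero] at h2; exact zero_ne_one h2
  refine ⟨2⁻¹, by rw [map_inv₀, h2, inv_one], ?_⟩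
  rw [map_inv₀, map_ofNat]
  field_simp
  norm_num

/-- **`|B₀ d y| ≤ r` when every coordinate of `d` has valuation `≤ r` and `y ∈ 𝒪^N`** (ultrametric inequality term by term). [cite: Omeara1963, §82F] -/
theorem v_B₀_le_of_forall_v_le (hvσ : ∀ a, Valued.v (σ a) = Valued.v a) {d y : Fin N → K} {r : ℤᵐ⁰}
    (hd : ∀ i, Valued.v (d i) ≤ r) (hy : y ∈ stdLattice K N) : Valued.v (B₀ σ N d y) ≤ r := by
  rw [B₀_apply]
  refine Valuation.map_sum_le _ fun i _ => ?_
  rw [map_mul, hvσ]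
  calc Valued.v (d i) * Valued.v (y (Fin.rev i)) ≤ r * 1 := mul_le_mul' (hd i) (hy _)
    _ = r := mul_one r

/-- **An integral matrix maps `𝒪^N` into `𝒪^N`.** [cite: Omeara1963, §82F] -/
theorem mulVec_mem_stdLattice_of_forall_v_le_one {M : Matrix (Fin N) (Fin N) K} (hM : ∀ i j, Valued.v (M i j) ≤ 1)
    {y : Fin N → K} (hy : y ∈ stdLattice K N) : M.mulVec y ∈ stdLattice K N := by
  intro i
  change Valued.v (∑ j, M i j * y j) ≤ 1
  refine Valuation.map_sum_le _ fun j _ => ?_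
  rw [map_mul]
  exact mul_le_one' (hM i j) (hy j)

/-- **`k ∈ K₀` maps `𝒪^N` into `𝒪^N`.** [cite: Tits1979, §3.3.3] -/
theorem mulVec_mem_stdLattice_of_mem_unitaryInt {H : Matrix (Fin N) (Fin N) K} {k : unitaryGroupOfForm σ H} (hk : k ∈ unitaryInt σ H)
    {y : Fin N → K} (hy : y ∈ stdLattice K N) : ((k : GL (Fin N) K) : Matrix (Fin N) (Fin N) K).mulVec y ∈ stdLattice K N :=
  mulVec_mem_stdLattice_of_forall_v_le_one (mem_unitaryInt_iff.1 hk).1 hy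

/-- **`k⁻¹` maps `𝒪^N` into `𝒪^N` for `k ∈ K₀`.** [cite: Tits1979, §3.3.3] -/
theorem mulVec_mem_stdLattice_of_mem_unitaryInt_inv {H : Matrix (Fin N) (Fin N) K} {k : unitaryGroupOfForm σ H} (hk : k ∈ unitaryInt σ H)
    {y : Fin N → K} (hy : y ∈ stdLattice K N) :
    (((k⁻¹ : unitaryGroupOfForm σ H) : GL (Fin N) K) : Matrix (Fin N) (Fin N) K).mulVec y ∈ stdLattice K N :=
  mulVec_mem_stdLattice_of_mem_unitaryInt (Subgroup.inv_mem _ hk) hy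

omit [Valued K ℤᵐ⁰] in
/-- **Unitarity with the inverse on the right: `B₀ (k u) y = B₀ u (k⁻¹ y)`** for `k ∈ U(σ, J₀)`. [cite: BruhatTits1972, (4.4.4)] -/
theorem B₀_mulVec_eq_B₀_inv_mulVec (k : unitaryGroupOfForm σ ((StdForm.antidiagonal N).over K)) (u y : Fin N → K) :
    B₀ σ N (((k : GL (Fin N) K) : Matrix (Fin N) (Fin N) K).mulVec u) y =
      B₀ σ N u ((((k⁻¹ : unitaryGroupOfForm σ ((StdForm.antidiagonal N).over K)) : GL (Fin N) K) : Matrix (Fin N) (Fin N) K).mulVec y) := by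
  have hy : ((k : GL (Fin N) K) : Matrix (Fin N) (Fin N) K).mulVec
      ((((k⁻¹ : unitaryGroupOfForm σ ((StdForm.antidiagonal N).over K)) : GL (Fin N) K) : Matrix (Fin N) (Fin N) K).mulVec y) = y := by
    rw [Matrix.mulVec_mulVec, Subgroup.coe_inv, ← Units.val_mul, mul_inv_cancel, Units.val_one, Matrix.one_mulVec]
  conv_lhs => rw [← hy]
  exact (mem_unitaryGroupOfForm_antidiagonal_iff (k : GL (Fin N) K)).1 k.2 u _

/-- **Congruent vectors define the same residual hyperplane**: if `x′ ≡ x` coordinatewise modulo elements of valuation `≤ r < 1`, then for `y ∈ 𝒪^N`,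
`B₀ x y ∈ 𝔪 ↔ B₀ x′ y ∈ 𝔪`. [cite: Serre1980Trees, II.1.1] -/
theorem v_B₀_lt_one_iff_of_congr (hvσ : ∀ a, Valued.v (σ a) = Valued.v a) {x x' y : Fin N → K} {r : ℤᵐ⁰} (hr : r < 1)
    (hxx' : ∀ i, Valued.v (x' i - x i) ≤ r) (hy : y ∈ stdLattice K N) :
    Valued.v (B₀ σ N x y) < 1 ↔ Valued.v (B₀ σ N x' y) < 1 := by
  have hdiff : Valued.v (B₀ σ N x' y - B₀ σ N x y) < 1 := by
    rw [← LinearMap.sub_apply, ← map_sub]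
    exact (v_B₀_le_of_forall_v_le hvσ hxx' hy).trans_lt hr
  constructor
  · intro h
    have : B₀ σ N x' y = (B₀ σ N x' y - B₀ σ N x y) + B₀ σ N x y := by ring
    rw [this]
    exact (Valuation.map_add _ _ _).trans_lt (max_lt hdiff h)
  · intro h
    have : B₀ σ N x y = B₀ σ N x' y - (B₀ σ N x' y - B₀ σ N x y) := by ring
    rw [this]
    exact (Valuation.map_sub _ _ _).trans_lt (max_lt h hdiff)

/-! ## §1 The isotropic lift of a residually isotropic primitive vector -/

/-- **ISOTROPIC LIFT.**  `σ` an involution preserving `v`, `τ` a trace element (`|τ| ≤ 1`, `τ + στ = 1`); `x ∈ 𝒪^N` with a UNIT coordinate at `j`, `rev j ≠ j`.  Then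
`x̃ := x − (τ·B₀ x x ∕ σ(x_j))·e_{rev j}` lies in `𝒪^N`, is EXACTLY ISOTROPIC (`B₀ x̃ x̃ = 0`), has `x̃_j = x_j`, and `|x̃_i − x_i| ≤ |B₀ x x|` for all `i` (so `x̃ ≡ x (mod 𝔪)` as
soon as `x` is residually isotropic).  The computation: `B₀ x̃ x̃ = a − cσ(x_j) − σ(c)x_j + |c|²·B₀(e_{rev j}, e_{rev j}) = a − τa − σ(τ)a + 0 = 0` (`a = B₀ x x = σa`).
[cite: Serre1980Trees, II.1.1] [cite: Omeara1963, §82F] -/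
theorem exists_isotropic_congr (hσ : ∀ a, σ (σ a) = a) (hvσ : ∀ a, Valued.v (σ a) = Valued.v a) {τ : K} (hτ : Valued.v τ ≤ 1) (hτσ : τ + σ τ = 1)
    {x : Fin N → K} (hx : x ∈ stdLattice K N) {j : Fin N} (hj : Fin.rev j ≠ j) (hxj : Valued.v (x j) = 1) :
    ∃ x' : Fin N → K, x' ∈ stdLattice K N ∧ B₀ σ N x' x' = 0 ∧ x' j = x j ∧ ∀ i, Valued.v (x' i - x i) ≤ Valued.v (B₀ σ N x x) := by
  set a : K := B₀ σ N x x with ha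
  have hσa : σ a = a := by
    rw [ha]
    exact isHermitianForm_B₀ (N := N) hσ x x
  have hxj0 : x j ≠ 0 := fun h => by rw [h, map_zero] at hxj; exact zero_ne_one hxj
  have hσxj0 : σ (x j) ≠ 0 := (map_ne_zero σ).2 hxj0
  set c : K := τ * a / σ (x j) with hc
  have hvc : Valued.v c ≤ Valued.v a := by
    rw [hc, map_div₀, map_mul, hvσ, hxj, div_one]
    exact mul_le_of_le_one_left' hτ
  have hva : Valued.v a ≤ 1 := v_B₀_le_one hvσ hx hx
  refine ⟨x - c • Pi.single (Fin.rev j) 1, ?_, ?_, ?_, ?_⟩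
  · -- integrality
    intro i
    rw [Pi.sub_apply, Pi.smul_apply, smul_eq_mul]
    refine (Valuation.map_sub _ _ _).trans (max_le (hx i) ?_)
    rw [map_mul]
    refine mul_le_one' (hvc.trans hva) ?_
    rw [Pi.single_apply]; split_ifs <;> simp
  · -- isotropy
    have hjj : Fin.rev (Fin.rev j) ≠ Fin.rev j := by rw [Fin.rev_rev]; exact hj.symm
    simp only [map_sub, map_smulₛₗ, LinearMap.sub_apply, LinearMap.smul_apply, B₀_single_left, B₀_single_right, Fin.rev_rev,
      Pi.single_eq_of_ne hj.symm, smul_eq_mul, RingHom.id_apply, map_zero, mul_zero, sub_zero]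
    rw [← ha]
    -- `a - c σ(x_j) - (σ c) x_j = 0` after substituting `c`
    have h1 : c * σ (x j) = τ * a := by rw [hc]; field_simp
    have h2 : σ c * x j = σ τ * a := by
      rw [hc, map_div₀, map_mul, hσa, hσ]; field_simp
    have hgoal : a - σ c * x j - (c * σ (x j)) = 0 := by
      rw [h1, h2]
      have : a = (τ + σ τ) * a := by rw [hτσ, one_mul]
      linear_combination this
    linear_combination hgoal
  · -- the `j`-coordinate is unchanged
    rw [Pi.sub_apply, Pi.smul_apply, Pi.single_eq_of_ne hj.symm, smul_zero, sub_zero]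
  · -- congruence modulo `a`
    intro i
    rw [Pi.sub_apply, Pi.smul_apply, sub_sub_cancel_left, Valuation.map_neg, smul_eq_mul, map_mul]
    refine (mul_le_of_le_one_right' ?_).trans hvc
    rw [Pi.single_apply]; split_ifs <;> simp

/-! ## §2 `K₀` reaches every residually isotropic primitive vector modulo `𝔪` -/

/-- **`K₀` MOVES `e_{i₀}` ONTO EVERY RESIDUALLY ISOTROPIC PRIMITIVE VECTOR MODULO `𝔪`.**  `σ` an involution preserving `v`, `τ` a trace element; `x ∈ 𝒪^N` primitive
(`∃ j, |x_j| = 1`) with `|B₀ x x| < 1`; `rev i₀ ≠ i₀`.  Then some `k ∈ K₀ = U(J₀)(𝒪)` has `|(k e_{i₀})_i − x_i| ≤ |B₀ x x|` for every `i` — by ★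
`exists_rev_ne_v_eq_one_of_v_B₀_lt_one` (a unit coordinate off the `rev`-fixed index), §1 (isotropic lift `x̃`) and ★ `exists_mem_unitaryInt_mulVec_single_eq` (`k e_{i₀} = x̃`).
At `N = 3`: the reduction of `K₀` acts transitively on the `q³ + 1` points of the residual Hermitian curve. [cite: BruhatTits1972, (4.4.4)] [cite: Tits1979, §3.3.3] -/
theorem exists_mem_unitaryInt_mulVec_single_congr (hσ : ∀ a, σ (σ a) = a) (hvσ : ∀ a, Valued.v (σ a) = Valued.v a)
    {τ : K} (hτ : Valued.v τ ≤ 1) (hτσ : τ + σ τ = 1)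
    {x : Fin N → K} (hx : x ∈ stdLattice K N) (hunit : ∃ j, Valued.v (x j) = 1) (hiso : Valued.v (B₀ σ N x x) < 1)
    {i₀ : Fin N} (hi₀ : Fin.rev i₀ ≠ i₀) :
    ∃ k : unitaryGroupOfForm σ ((StdForm.antidiagonal N).over K),
      k ∈ unitaryInt σ ((StdForm.antidiagonal N).over K) ∧
        ∀ i, Valued.v (((k : GL (Fin N) K) : Matrix (Fin N) (Fin N) K).mulVec (Pi.single i₀ 1) i - x i) ≤ Valued.v (B₀ σ N x x) := by
  obtain ⟨j, hj, hxj⟩ := exists_rev_ne_v_eq_one_of_v_B₀_lt_one hvσ hx hunit hiso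
  obtain ⟨x', hx'L, hx'iso, hx'j, hx'x⟩ := exists_isotropic_congr hσ hvσ hτ hτσ hx hj hxj
  obtain ⟨k, hk, hkx⟩ := exists_mem_unitaryInt_mulVec_single_eq hσ hvσ hx'L ⟨j, by rw [hx'j]; exact hxj⟩ hx'iso hi₀
  exact ⟨k, hk, fun i => by rw [hkx]; exact hx'x i⟩

/-! ## §3 The lattice dress: `N_x = k · N_{e_{i₀}}` (definition-free root-star transitivity) -/

/-- **ROOT-STAR TRANSITIVITY, ONE-VECTOR FORM: `N_x = k · N_{e_{i₀}}`.**  Under the hypotheses of §2 there is `k ∈ K₀` such that for every `y ∈ 𝒪^N`: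
`B₀ x y ∈ 𝔪 ↔ (k⁻¹ y)_{rev i₀} ∈ 𝔪` — i.e. `k` maps the standard isotropic-line neighbour `N_{e_{i₀}} = {y ∈ 𝒪^N | y_{rev i₀} ∈ 𝔪}` of the root `𝒪^N` onto
`N_x = {y ∈ 𝒪^N | B₀ x y ∈ 𝔪}` (unitarity `B₀(k e_{i₀}, y) = (k⁻¹ y)_{rev i₀}` + the congruence `k e_{i₀} ≡ x`).  At `N = 3` (unramified `U(3)`): every type-one vertex adjacent to
the hyperspecial vertex `L₀` of the Bruhat–Tits tree is a `K₀`-translate of `latt diag(1, 1, ϖ)` (take `i₀ = 0`). [cite: BruhatTits1972, (4.4.4) and §10] [cite: Serre1980Trees, II.1.1] -/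
theorem exists_mem_unitaryInt_rootStar_eq (hσ : ∀ a, σ (σ a) = a) (hvσ : ∀ a, Valued.v (σ a) = Valued.v a)
    {τ : K} (hτ : Valued.v τ ≤ 1) (hτσ : τ + σ τ = 1)
    {x : Fin N → K} (hx : x ∈ stdLattice K N) (hunit : ∃ j, Valued.v (x j) = 1) (hiso : Valued.v (B₀ σ N x x) < 1)
    {i₀ : Fin N} (hi₀ : Fin.rev i₀ ≠ i₀) :
    ∃ k : unitaryGroupOfForm σ ((StdForm.antidiagonal N).over K),
      k ∈ unitaryInt σ ((StdForm.antidiagonal N).over K) ∧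
        ∀ y ∈ stdLattice K N,
          (Valued.v (B₀ σ N x y) < 1 ↔
            Valued.v ((((k⁻¹ : unitaryGroupOfForm σ ((StdForm.antidiagonal N).over K)) : GL (Fin N) K) : Matrix (Fin N) (Fin N) K).mulVec y
              (Fin.rev i₀)) < 1) := by
  obtain ⟨k, hk, hkx⟩ := exists_mem_unitaryInt_mulVec_single_congr hσ hvσ hτ hτσ hx hunit hiso hi₀
  refine ⟨k, hk, fun y hy => ?_⟩
  rw [v_B₀_lt_one_iff_of_congr hvσ hiso hkx hy, B₀_mulVec_eq_B₀_inv_mulVec, B₀_single_left]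

/-! ## §4 Two-vector form: `K₀` permutes the residual isotropic hyperplanes transitively -/

/-- **ROOT-STAR TRANSITIVITY: `N_{x′} = k · N_x`.**  `σ` an involution preserving `v`, `τ` a trace element, `N ≥ 2` in the guise of an index `i₀` with `rev i₀ ≠ i₀`; `x, x′ ∈ 𝒪^N`
both primitive and residually isotropic (`|B₀ x x|, |B₀ x′ x′| < 1`).  Then some `k ∈ K₀` satisfies, for every `y ∈ 𝒪^N`: `B₀ x′ y ∈ 𝔪 ↔ B₀ x (k⁻¹ y) ∈ 𝔪` — the
isotropic-line neighbours of the hyperspecial vertex form ONE `K₀`-orbit (at `N = 3`: the star of `L₀` in the `(q³+1, q+1)`-tree of the unramified `U(3)` is homogeneous under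
`K₀`; the flag-transitivity binder of the rank-3 twin of ★ `HermitianLatticeTreeEulerRelation`). [cite: BruhatTits1972, (4.4.4) and §10] [cite: Tits1979, §3.3.3] -/
theorem exists_mem_unitaryInt_rootStar_transitive (hσ : ∀ a, σ (σ a) = a) (hvσ : ∀ a, Valued.v (σ a) = Valued.v a)
    {τ : K} (hτ : Valued.v τ ≤ 1) (hτσ : τ + σ τ = 1) {i₀ : Fin N} (hi₀ : Fin.rev i₀ ≠ i₀)
    {x : Fin N → K} (hx : x ∈ stdLattice K N) (hunit : ∃ j, Valued.v (x j) = 1) (hiso : Valued.v (B₀ σ N x x) < 1)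
    {x' : Fin N → K} (hx' : x' ∈ stdLattice K N) (hunit' : ∃ j, Valued.v (x' j) = 1) (hiso' : Valued.v (B₀ σ N x' x') < 1) :
    ∃ k : unitaryGroupOfForm σ ((StdForm.antidiagonal N).over K),
      k ∈ unitaryInt σ ((StdForm.antidiagonal N).over K) ∧
        ∀ y ∈ stdLattice K N,
          (Valued.v (B₀ σ N x' y) < 1 ↔
            Valued.v (B₀ σ N x ((((k⁻¹ : unitaryGroupOfForm σ ((StdForm.antidiagonal N).over K)) : GL (Fin N) K) : Matrix (Fin N) (Fin N) K).mulVec y)) < 1) := by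
  obtain ⟨k₁, hk₁, h₁⟩ := exists_mem_unitaryInt_rootStar_eq hσ hvσ hτ hτσ hx hunit hiso hi₀
  obtain ⟨k₂, hk₂, h₂⟩ := exists_mem_unitaryInt_rootStar_eq hσ hvσ hτ hτσ hx' hunit' hiso' hi₀
  refine ⟨k₂ * k₁⁻¹, Subgroup.mul_mem _ hk₂ (Subgroup.inv_mem _ hk₁), fun y hy => ?_⟩
  -- `z := (k₂ k₁⁻¹)⁻¹ y = k₁ k₂⁻¹ y ∈ 𝒪^N` and `k₁⁻¹ z = k₂⁻¹ y`
  have hz : ((((k₂ * k₁⁻¹)⁻¹ : unitaryGroupOfForm σ ((StdForm.antidiagonal N).over K)) : GL (Fin N) K) : Matrix (Fin N) (Fin N) K).mulVec y ∈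
      stdLattice K N :=
    mulVec_mem_stdLattice_of_mem_unitaryInt (Subgroup.inv_mem _ (Subgroup.mul_mem _ hk₂ (Subgroup.inv_mem _ hk₁))) hy
  rw [h₂ y hy, h₁ _ hz, Matrix.mulVec_mulVec]
  have hmat : (((k₁⁻¹ : unitaryGroupOfForm σ ((StdForm.antidiagonal N).over K)) : GL (Fin N) K) : Matrix (Fin N) (Fin N) K) *
      ((((k₂ * k₁⁻¹)⁻¹ : unitaryGroupOfForm σ ((StdForm.antidiagonal N).over K)) : GL (Fin N) K) : Matrix (Fin N) (Fin N) K) =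
      (((k₂⁻¹ : unitaryGroupOfForm σ ((StdForm.antidiagonal N).over K)) : GL (Fin N) K) : Matrix (Fin N) (Fin N) K) := by
    rw [← Units.val_mul, ← Subgroup.coe_mul]
    congr 2
    group
  rw [hmat]

end Literature.NumberTheory.Automorphic.HermitianLattice

end
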